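import Summits.BirchSwinnertonDyer.BirchSwinnertonDyer.Theorems.CorpuzLei2025_sharpFlatMainConjecture_transfer_OPEN
import Summits.BirchSwinnertonDyer.BirchSwinnertonDyer.Theorems.SignedLowerHalvesSprungLowerHalfAtThreeCMCongruencesB
import Summits.BirchSwinnertonDyer.BirchSwinnertonDyer.Theorems.Rank1ResidualIntModelReduction
import Summits.BirchSwinnertonDyer.BirchSwinnertonDyer.Theorems.Rank1ResidualX11RankOneReduction
import Summits.BirchSwinnertonDyer.Rank1Residual.Supersingular.RankOneRem13NoCertificate
import Literature.NumberTheory.EllipticCurves.PointCountEulerCriterion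
import Literature.NumberTheory.EllipticCurves.ComplexMultiplicationHasCMProofs
import HarnessLib

/-!
# Route `SignedLowerHalves`, crux `SprungLowerHalfAtThree` (item stmt-BirchSwinnertonDyer-19003) — PER-PAIR records of the
# CM-congruence transfer line on X8: `BSD(E,3)` MODULO the Corpuz–Lei ♯/♭ PRE binder for the two small-image X8 cells WITHOUT a
# per-pair theorem of record (`288800cu1`, `116032by1`), and the unit-case exemplar `396704db1` with the partner's `μ`-node DISCHARGED
# (cell `bsd-ssimc`, seat `bsd-ssimc-k3-c5` gen 3)

HONEST FRAMING: every theorem here is CONDITIONAL on the OPEN binder `CorpuzLei2025_sharpFlatMainConjecture_transfer_OPEN`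
(UNREFEREED preprint arXiv:2508.09733; audit points in that file's docstring), on the PUBLISHED named facts it lists
(Pollack–Rubin 2004, the period-unit facts, modularity, `hasEntireLFunction_rat`, GZK) and on the displayed per-pair data
(`r_an(E) = 0` from Cremona's table; for the two rank-≥1 partners the `μ`-node `SignedMuVanishing E′ 3`, numerically
`μ⁺ = μ⁻ = 0` by ONE engine — PARI `ellpadiclambdamu`, kit j251242/j251266/j251433 — NOT a certificate; for `396704db1` the
single `L`-value datum `L(E′,1)/Ω_{E′} = 1` of `E′ : y² = x³ + 7x`). The 3-congruences are the KERNEL theorems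
`threeTorsionIso_c<label>` (`…CMCongruencesA/B.lean`); every Galois / reduction datum of both curves is decided in the kernel
from the integer models. Nothing is booked: the lane books, the referee rules; X8 stays CONSTRUCTION-SHAPED; crux 5 stays OPEN.

What this buys (planner's A8 v2 table): `288800cu1` (`Ш_an = 81`, status NONE) and `116032by1` (`Ш_an = 9`, cert/row-only) get
a per-pair `BSDp` theorem modulo ONE PRE binder + the partner's `μ`-node; `396704db1` (already flag-free by 3-descent) shows the line end-to-end with the `μ`-node discharged by
`signedMuVanishing_of_frobeniusTrace_eq_zero` through the generic `signedMuVanishing_of_lvalue_three` (any unit `L`-value).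

References: [CorpuzLei2025] Thm. 5.10; [PollackRubin2004] Thm. (p. 448); [Fisher2012Hessian] Thm. 13.2, §13 (n = 3);
[Sprung2012] Main Conj. 7.21; [PerrinRiou2003] Conj. 6.1.1; [Kurihara2002] Thm. 0.1 (unit case); [Cremona2006] Table 1;
[SilvermanAEC2009] VII.1, App. C §11. Memo `HOME/bsd-ssimc-k3-c5-MEMO-3.md` §3.
-/

set_option autoImplicit false
set_option linter.dupNamespace false

noncomputable section

open scoped Classical MatrixGroups ModularForm

open CongruenceSubgroup WeierstrassCurve Literature.NumberTheory.EllipticCurves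
  Literature.NumberTheory.EllipticCurves.ModularForms
  Literature.NumberTheory.EllipticCurves.Rank1Residual
  Literature.NumberTheory.EllipticCurves.Rank1Residual.Typed
  Summit.BirchSwinnertonDyer.Rank1Residual.Supersingular
  Literature.NumberTheory.EllipticCurves.Rank1Residual.X11RankOneCertificates
  Summit.BirchSwinnertonDyer.BirchSwinnertonDyer.Rank1Residual.IntModel
  Summit.BirchSwinnertonDyer.BirchSwinnertonDyer.Rank1Residual.X11RankOne
  Summit.BirchSwinnertonDyer.Rank1Residual.X11b

namespace Summit.BirchSwinnertonDyer.BirchSwinnertonDyer.Theorems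

/-! ### §1. `j = 1728` for the partners (class / reduction data are read off the integer models by the tree's
`Supersingular.classX8_of_intModel` / `goodSS_of_intModel` / `IntModel.frobeniusTrace_eq`) -/

/-- **`y² = x³ + Ax` has `j = 1728`** (`c₄ = −48A`, `Δ = −64A³`). [cite: SilvermanAEC2009, App. C §11, Example 11.3.1] -/
theorem j_shortCM_eq (A : ℚ) [h : (⟨0, 0, 0, A, 0⟩ : WeierstrassCurve ℚ).IsElliptic] :
    (⟨0, 0, 0, A, 0⟩ : WeierstrassCurve ℚ).j = 1728 := by
  set V : WeierstrassCurve ℚ := ⟨0, 0, 0, A, 0⟩ with hV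
  have hΔ : V.Δ = -64 * A ^ 3 := by
    simp only [hV, WeierstrassCurve.Δ, WeierstrassCurve.b₂, WeierstrassCurve.b₄, WeierstrassCurve.b₆,
      WeierstrassCurve.b₈]; ring
  have hc4 : V.c₄ = -48 * A := by
    simp only [hV, WeierstrassCurve.c₄, WeierstrassCurve.b₂, WeierstrassCurve.b₄]; ring
  have hA : A ≠ 0 := by
    intro hA0
    have hu : IsUnit V.Δ := h.isUnit
    rw [hΔ, hA0] at hu
    norm_num at hu
  rw [WeierstrassCurve.j, Units.val_inv_eq_inv_val, WeierstrassCurve.coe_Δ', hΔ, hc4]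
  field_simp
  ring

/-! ### §2. Kernel-decided data of the three literal pairs -/

/-- `#Ẽ(𝔽₃) = 1` for `288800cu1 = [0,0,0,−28979275,−60045400750]` (`a_3 = 3`). [cite: Cremona2006, Table 1 (Cremona label 288800cu1)] -/
theorem card_c288800cu1_3 :
    Nat.card (((⟨0, 0, 0, -28979275, -60045400750⟩ : WeierstrassCurve ℤ).map
      (Int.castRingHom (ZMod 3))).toAffine.Point) = 1 := by
  rw [@WeierstrassCurve.natCard_point_eq_one_add_card (ZMod 3) (@ZMod.instField 3 ⟨by norm_num⟩) _ _ _
    (by decide +kernel), @card_sol_eq_sum_euler (ZMod 3) (@ZMod.instField 3 ⟨by norm_num⟩) _ _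
    (by rw [ZMod.ringChar_zmod_n]; decide), ZMod.card]
  decide +kernel

/-- `#Ẽ(𝔽₃) = 1` for `116032by1 = [0,0,0,−12838,−559090]` (`a_3 = 3`). [cite: Cremona2006, Table 1 (Cremona label 116032by1)] -/
theorem card_c116032by1_3 :
    Nat.card (((⟨0, 0, 0, -12838, -559090⟩ : WeierstrassCurve ℤ).map
      (Int.castRingHom (ZMod 3))).toAffine.Point) = 1 := by
  rw [@WeierstrassCurve.natCard_point_eq_one_add_card (ZMod 3) (@ZMod.instField 3 ⟨by norm_num⟩) _ _ _
    (by decide +kernel), @card_sol_eq_sum_euler (ZMod 3) (@ZMod.instField 3 ⟨by norm_num⟩) _ _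
    (by rw [ZMod.ringChar_zmod_n]; decide), ZMod.card]
  decide +kernel

/-- `#Ẽ(𝔽₃) = 1` for `396704db1 = [0,0,0,−1730092,−872350528]` (`a_3 = 3`). [cite: Cremona2006, Table 1 (Cremona label 396704db1)] -/
theorem card_c396704db1_3 :
    Nat.card (((⟨0, 0, 0, -1730092, -872350528⟩ : WeierstrassCurve ℤ).map
      (Int.castRingHom (ZMod 3))).toAffine.Point) = 1 := by
  rw [@WeierstrassCurve.natCard_point_eq_one_add_card (ZMod 3) (@ZMod.instField 3 ⟨by norm_num⟩) _ _ _
    (by decide +kernel), @card_sol_eq_sum_euler (ZMod 3) (@ZMod.instField 3 ⟨by norm_num⟩) _ _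
    (by rw [ZMod.ringChar_zmod_n]; decide), ZMod.card]
  decide +kernel

/-- `#Ẽ′(𝔽₃) = 4` for the partner `y² = x³ + 475x` (`a_3 = 0`). [folklore] -/
theorem card_cm475_3 :
    Nat.card (((⟨0, 0, 0, 475, 0⟩ : WeierstrassCurve ℤ).map (Int.castRingHom (ZMod 3))).toAffine.Point) = 4 := by
  rw [@WeierstrassCurve.natCard_point_eq_one_add_card (ZMod 3) (@ZMod.instField 3 ⟨by norm_num⟩) _ _ _
    (by decide +kernel), @card_sol_eq_sum_euler (ZMod 3) (@ZMod.instField 3 ⟨by norm_num⟩) _ _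
    (by rw [ZMod.ringChar_zmod_n]; decide), ZMod.card]
  decide +kernel

/-- `#Ẽ′(𝔽₃) = 4` for the partner `y² = x³ + 49x` (`a_3 = 0`). [folklore] -/
theorem card_cm49_3 :
    Nat.card (((⟨0, 0, 0, 49, 0⟩ : WeierstrassCurve ℤ).map (Int.castRingHom (ZMod 3))).toAffine.Point) = 4 := by
  rw [@WeierstrassCurve.natCard_point_eq_one_add_card (ZMod 3) (@ZMod.instField 3 ⟨by norm_num⟩) _ _ _
    (by decide +kernel), @card_sol_eq_sum_euler (ZMod 3) (@ZMod.instField 3 ⟨by norm_num⟩) _ _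
    (by rw [ZMod.ringChar_zmod_n]; decide), ZMod.card]
  decide +kernel

/-- `#Ẽ′(𝔽₃) = 4` for the partner `y² = x³ + 7x` (`a_3 = 0`). [folklore] -/
theorem card_cm7_3 :
    Nat.card (((⟨0, 0, 0, 7, 0⟩ : WeierstrassCurve ℤ).map (Int.castRingHom (ZMod 3))).toAffine.Point) = 4 := by
  rw [@WeierstrassCurve.natCard_point_eq_one_add_card (ZMod 3) (@ZMod.instField 3 ⟨by norm_num⟩) _ _ _
    (by decide +kernel), @card_sol_eq_sum_euler (ZMod 3) (@ZMod.instField 3 ⟨by norm_num⟩) _ _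
    (by rw [ZMod.ringChar_zmod_n]; decide), ZMod.card]
  decide +kernel

/-- The literal models are elliptic and globally minimal (`Δ ≠ 0`, Kraus' bounded criterion; kernel). Already in the tree and
REUSED by users of the `116032by1` record (not restated here): `SecondDescent.isElliptic_s116032by1` /
`isGloballyMinimal_s116032by1`. [cite: SilvermanAEC2009, VII.1 Remark 1.1] -/
theorem isElliptic_c288800cu1 : (⟨0, 0, 0, -28979275, -60045400750⟩ : WeierstrassCurve ℚ).IsElliptic :=
  isElliptic_of_discOf_ne_zero 0 0 0 (-28979275) (-60045400750) (by decide +kernel)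
/-- [cite: SilvermanAEC2009, VII.1 Remark 1.1] -/
theorem isGloballyMinimal_c288800cu1 : (⟨0, 0, 0, -28979275, -60045400750⟩ : WeierstrassCurve ℚ).IsGloballyMinimal :=
  isGloballyMinimal_of_krausCriterion_bounded₂ 0 0 0 (-28979275) (-60045400750) (by decide +kernel)
    (by decide +kernel) (by decide +kernel)
/-- [cite: SilvermanAEC2009, VII.1 Remark 1.1] -/
theorem isElliptic_c396704db1 : (⟨0, 0, 0, -1730092, -872350528⟩ : WeierstrassCurve ℚ).IsElliptic :=
  isElliptic_of_discOf_ne_zero 0 0 0 (-1730092) (-872350528) (by decide +kernel)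
/-- [cite: SilvermanAEC2009, VII.1 Remark 1.1] -/
theorem isGloballyMinimal_c396704db1 : (⟨0, 0, 0, -1730092, -872350528⟩ : WeierstrassCurve ℚ).IsGloballyMinimal :=
  isGloballyMinimal_of_krausCriterion_bounded₂ 0 0 0 (-1730092) (-872350528) (by decide +kernel) (by decide +kernel)
    (by decide +kernel)
/-- [cite: SilvermanAEC2009, VII.1 Remark 1.1] -/
theorem isElliptic_cm7 : (⟨0, 0, 0, 7, 0⟩ : WeierstrassCurve ℚ).IsElliptic :=
  isElliptic_of_discOf_ne_zero 0 0 0 7 0 (by decide +kernel)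
/-- [cite: SilvermanAEC2009, VII.1 Remark 1.1] -/
theorem isGloballyMinimal_cm7 : (⟨0, 0, 0, 7, 0⟩ : WeierstrassCurve ℚ).IsGloballyMinimal :=
  isGloballyMinimal_of_krausCriterion_bounded₂ 0 0 0 7 0 (by decide +kernel) (by decide +kernel) (by decide +kernel)
/-- [cite: SilvermanAEC2009, VII.1 Remark 1.1] -/
theorem isElliptic_cm475 : (⟨0, 0, 0, 475, 0⟩ : WeierstrassCurve ℚ).IsElliptic :=
  isElliptic_of_discOf_ne_zero 0 0 0 475 0 (by decide +kernel)
/-- [cite: SilvermanAEC2009, VII.1 Remark 1.1] -/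
theorem isGloballyMinimal_cm475 : (⟨0, 0, 0, 475, 0⟩ : WeierstrassCurve ℚ).IsGloballyMinimal :=
  isGloballyMinimal_of_krausCriterion_bounded₂ 0 0 0 475 0 (by decide +kernel) (by decide +kernel) (by decide +kernel)
/-- [cite: SilvermanAEC2009, VII.1 Remark 1.1] -/
theorem isElliptic_cm49 : (⟨0, 0, 0, 49, 0⟩ : WeierstrassCurve ℚ).IsElliptic :=
  isElliptic_of_discOf_ne_zero 0 0 0 49 0 (by decide +kernel)
/-- [cite: SilvermanAEC2009, VII.1 Remark 1.1] -/
theorem isGloballyMinimal_cm49 : (⟨0, 0, 0, 49, 0⟩ : WeierstrassCurve ℚ).IsGloballyMinimal :=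
  isGloballyMinimal_of_krausCriterion_bounded₂ 0 0 0 49 0 (by decide +kernel) (by decide +kernel) (by decide +kernel)

/-! ### §3. The records -/

section Records

variable (hCL : CorpuzLei2025_sharpFlatMainConjecture_transfer_OPEN)
  (hPR : PollackRubin2004.mainTheorem_signedCharIdeal_eq_of_cm)
  (h5 : realPeriodRat_eq_unit_mul_plusPeriod) (h3 : realPeriodRat_eq_unit_mul_plusPeriod_three)
  (hmodE : exists_isNewformOf) (hmod : hasEntireLFunction_rat)
  (hGZK : rank_eq_analyticRank_of_analyticRank_le_one)
include hCL hPR h5 h3 hmodE hmod hGZK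

/-- **`BSD(E,3)` for `288800cu1`** (X8: `N = 288800 = 2⁵·5²·19²`, good supersingular at `3` with `a_3 = 3`, image `3Nn`, rank `0`,
`#Ш_an = 81` — the ONLY 3Nn X8 cell of the window with NO per-pair theorem of record) **MODULO the Corpuz–Lei ♯/♭ PRE binder
(`hCL`) and the `μ`-node of its CM partner `E′ : y² = x³ + 475x`** (`hμ`; `N′ = 288800`, analytic rank `2`; engine-A reading
`[λ⁺,λ⁻],[μ⁺,μ⁻] = [4,2],[0,0]`, kit j251433 — numerics, NOT a certificate). The congruence `E[3] ≅ E′[3]` is the kernel theorem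
`threeTorsionIso_c288800cu1` (dual Hesse pencil, `l₀ = −380`); `ClassX8`, `GoodSS E′ 3`, `a_3(E′) = 0`, `E′` CM (`j = 1728`) are
decided here; `r_an(E) = 0` is Cremona's datum `h0`. PER PAIR; nothing booked. [claim: CorpuzLei2025, status: under-review]
[cite: PollackRubin2004, Theorem (p. 448) = Thm. 7.3] [cite: Fisher2012Hessian, §13 (n = 3)] [cite: Cremona2006, Table 1 (Cremona label 288800cu1)] -/
theorem X8.bsdp_c288800cu1_of_cmPartner_of_transfer_OPEN
    (W : WeierstrassCurve ℚ) [W.IsElliptic] [W.IsGloballyMinimal] (hW : W = ⟨0, 0, 0, -28979275, -60045400750⟩)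
    (W' : WeierstrassCurve ℚ) [W'.IsElliptic] [W'.IsGloballyMinimal] (hW' : W' = ⟨0, 0, 0, 475, 0⟩)
    (h0 : W.analyticRank = 0) (hμ : SignedMuVanishing W' 3) : BSDp W 3 := by
  have hIW : integralModelInt W = ⟨0, 0, 0, -28979275, -60045400750⟩ :=
    integralModelInt_eq_of_map_eq _ (by rw [hW]; ext <;> simp [WeierstrassCurve.map])
  have hIW' : integralModelInt W' = ⟨0, 0, 0, 475, 0⟩ :=
    integralModelInt_eq_of_map_eq _ (by rw [hW']; ext <;> simp [WeierstrassCurve.map])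
  have hX : ClassX8 W 3 := classX8_of_intModel hIW
    (by rw [intCurve_Δ 0 0 0 (-28979275) (-60045400750)]; decide +kernel) card_c288800cu1_3 (Or.inl rfl)
  have hss' : GoodSS W' 3 := goodSS_of_intModel 3 hIW'
    (by rw [intCurve_Δ 0 0 0 (475) 0]; decide +kernel) card_cm475_3 (by decide)
  have hap' : W'.frobeniusTrace 3 = 0 := by rw [frobeniusTrace_eq hIW' card_cm475_3]; norm_num
  have hcm' : W'.HasCM := hasCM_of_j_eq_1728 W' (by subst hW'; exact j_shortCM_eq 475)
  subst hW; subst hW'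
  exact X8.bsdp_of_cmPartner_of_transfer_OPEN_of_analyticRank_eq_zero _ _ 3 hCL hPR h5 h3 hmodE hmod hGZK hX h0
    hcm' hss' hap' threeTorsionIso_c288800cu1 hμ

/-- **`BSD(E,3)` for `116032by1`** (X8: good supersingular at `3`, `a_3 = 3`, image `3Nn`, rank `0`, `#Ш_an = 9`; status
cert/row-only in the planner's table) **MODULO the PRE binder and the `μ`-node of its CM partner `E′ : y² = x³ + 49x`**
(`N′ = 3136`, analytic rank `1`; engine-A reading `[3,1],[0,0]`, kit j251242 — numerics). Congruence = `threeTorsionIso_c116032by1`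
(dual pencil, `l₀ = −140`). PER PAIR; nothing booked. [claim: CorpuzLei2025, status: under-review]
[cite: PollackRubin2004, Theorem (p. 448) = Thm. 7.3] [cite: Fisher2012Hessian, §13 (n = 3)] [cite: Cremona2006, Table 1 (Cremona label 116032by1)] -/
theorem X8.bsdp_c116032by1_of_cmPartner_of_transfer_OPEN
    (W : WeierstrassCurve ℚ) [W.IsElliptic] [W.IsGloballyMinimal] (hW : W = ⟨0, 0, 0, -12838, -559090⟩)
    (W' : WeierstrassCurve ℚ) [W'.IsElliptic] [W'.IsGloballyMinimal] (hW' : W' = ⟨0, 0, 0, 49, 0⟩)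
    (h0 : W.analyticRank = 0) (hμ : SignedMuVanishing W' 3) : BSDp W 3 := by
  have hIW : integralModelInt W = ⟨0, 0, 0, -12838, -559090⟩ :=
    integralModelInt_eq_of_map_eq _ (by rw [hW]; ext <;> simp [WeierstrassCurve.map])
  have hIW' : integralModelInt W' = ⟨0, 0, 0, 49, 0⟩ :=
    integralModelInt_eq_of_map_eq _ (by rw [hW']; ext <;> simp [WeierstrassCurve.map])
  have hX : ClassX8 W 3 := classX8_of_intModel hIW
    (by rw [intCurve_Δ 0 0 0 (-12838) (-559090)]; decide +kernel) card_c116032by1_3 (Or.inl rfl)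
  have hss' : GoodSS W' 3 := goodSS_of_intModel 3 hIW'
    (by rw [intCurve_Δ 0 0 0 (49) 0]; decide +kernel) card_cm49_3 (by decide)
  have hap' : W'.frobeniusTrace 3 = 0 := by rw [frobeniusTrace_eq hIW' card_cm49_3]; norm_num
  have hcm' : W'.HasCM := hasCM_of_j_eq_1728 W' (by subst hW'; exact j_shortCM_eq 49)
  subst hW; subst hW'
  exact X8.bsdp_of_cmPartner_of_transfer_OPEN_of_analyticRank_eq_zero _ _ 3 hCL hPR h5 h3 hmodE hmod hGZK hX h0
    hcm' hss' hap' threeTorsionIso_c116032by1 hμ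

omit hCL hPR hmod hGZK in
/-- **Unit case for a partner: `SignedMuVanishing W′ 3` from ONE `L`-value datum.** `W′` with good supersingular reduction
at `3` and `a_3 = 0`; if `L(W′,1)/Ω_{W′} = t` with `t ≠ 0` a `3`-adic unit, then `[0]⁺_{f′} = t·Ω_{W′}/Ω⁺_{f′}` is a `3`-adic unit
(period unit `h3`, modularity `hmodE` for the newform `f′`), so the node is the tree THEOREM
`signedMuVanishing_of_frobeniusTrace_eq_zero` (Kurihara's unit case). [cite: Kurihara2002, Thm. 0.1]
[cite: GreenbergVatsal2000, §3 Remark 3.4] [cite: Kobayashi2003, (3.6) (p. 7)] -/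
theorem signedMuVanishing_of_lvalue_three (W' : WeierstrassCurve ℚ) [W'.IsElliptic] [W'.IsGloballyMinimal]
    (hss' : GoodSS W' 3) (hap' : W'.frobeniusTrace 3 = 0) {t : ℚ}
    (hL1 : W'.entireLFunction 1 / (W'.realPeriodRat : ℂ) = (t : ℂ)) (ht0 : t ≠ 0) (htv : padicValRat 3 t = 0) :
    SignedMuVanishing W' 3 := by
  have hirr' : W'.HasIrreducibleModPGaloisRep 3 :=
    hasIrreducibleModPGaloisRep_of_dvd_frobeniusTrace W' 3 (by decide)
      (W'.not_dvd_minimalDiscriminantInt_of_hasGoodReductionAtPrime' 3 hss'.1) hss'.2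
  haveI hN : NeZero (W'.conductorNorm ℤ) := ⟨(W'.conductorNorm_pos_holds).ne'⟩
  obtain ⟨f, hf⟩ := hmodE W'
  obtain ⟨u, hu1, hΩ⟩ := h3 W' hss'.1 hirr' f hf
  have hΩpos : 0 < W'.realPeriodRat := W'.realPeriodRat_pos_holds
  have hΩf : 0 < plusPeriod f := IsNewform0.plusPeriod_pos_holds hf.1 hf.coeffField_eq_bot
  have hu0 : u ≠ 0 := by
    intro h; rw [h, Rat.cast_zero, norm_zero] at hu1; exact zero_ne_one hu1
  set s : ℚ := ratPlusSymbol f 0 with hs_def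
  have hLval : W'.entireLFunction 1 = (((s : ℝ) * plusPeriod f : ℝ) : ℂ) := hf.entireLFunction_one_eq
  -- `s · Ω⁺_f = t · Ω_{W′} = t · u · Ω⁺_f`, so `s = t · u`
  have hsR : (s : ℝ) * plusPeriod f = (t : ℝ) * W'.realPeriodRat := by
    have h1 : W'.entireLFunction 1 = (t : ℂ) * (W'.realPeriodRat : ℂ) := by
      rw [← hL1, div_mul_cancel₀ _ (Complex.ofReal_ne_zero.mpr hΩpos.ne')]
    have h2 : ((((s : ℝ) * plusPeriod f : ℝ)) : ℂ) = (((t : ℝ) * W'.realPeriodRat : ℝ) : ℂ) := by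
      rw [← hLval, h1]; push_cast; ring
    exact Complex.ofReal_injective h2
  have hs : s = t * u := by
    rw [hΩ, ← mul_assoc] at hsR
    have := mul_right_cancel₀ hΩf.ne' hsR
    exact_mod_cast this
  have hs0 : s ≠ 0 := by rw [hs]; exact mul_ne_zero ht0 hu0
  have hvu : padicValRat 3 u = 0 := by
    have hϖ : ((u⁻¹ : ℚ) : ℝ) * W'.realPeriodRat = plusPeriod f := by
      rw [hΩ, Rat.cast_inv, ← mul_assoc, inv_mul_cancel₀ (Rat.cast_ne_zero.mpr hu0), one_mul]
    have h := padicValRat_periodRatio_eq_zero h5 h3 W' 3 (by decide) hss'.1 hirr' f hf u⁻¹ hϖ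
    rwa [padicValRat.inv, neg_eq_zero] at h
  have hv : padicValRat 3 s = 0 := by
    rw [hs, padicValRat.mul ht0 hu0, hvu, add_zero, htv]
  intro _ f₁ hf₁ Lsharp Lflat hSP c
  exact signedMuVanishing_of_frobeniusTrace_eq_zero (by decide) hss'.1 hap' hf hs0 hv f₁ hf₁ Lsharp Lflat hSP c

/-- **`BSD(E,3)` for `396704db1` — the UNIT-CASE exemplar with the partner's `μ`-node DISCHARGED** (X8: `a_3 = 3`, `3Nn`,
rank `0`, `#Ш_an = 1`; already flag-free by exact 3-descent — this record shows the transfer line end-to-end). Partner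
`E′ : y² = x³ + 7x` (`N′ = 1568`, rank `0`), congruence `threeTorsionIso_c396704db1` (dual Hesse pencil, `l₀ = −56`). The only
per-pair datum besides `r_an(E) = 0` is the `L`-VALUE LINE `hL1 : L(E′,1)/Ω_{E′} = 1` (PARI, kit j251003): by
`signedMuVanishing_of_lvalue_three` the node `SignedMuVanishing E′ 3` is then a THEOREM. MODULO the PRE binder `hCL`; PER PAIR;
nothing booked. [claim: CorpuzLei2025, status: under-review] [cite: PollackRubin2004, Theorem (p. 448) = Thm. 7.3]
[cite: Kurihara2002, Thm. 0.1] [cite: Fisher2012Hessian, §13 (n = 3)] [cite: Cremona2006, Table 1 (Cremona label 396704db1)] -/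
theorem X8.bsdp_c396704db1_of_cmPartner_of_transfer_OPEN
    (W : WeierstrassCurve ℚ) [W.IsElliptic] [W.IsGloballyMinimal] (hW : W = ⟨0, 0, 0, -1730092, -872350528⟩)
    (W' : WeierstrassCurve ℚ) [W'.IsElliptic] [W'.IsGloballyMinimal] (hW' : W' = ⟨0, 0, 0, 7, 0⟩)
    (h0 : W.analyticRank = 0)
    (hL1 : W'.entireLFunction 1 / (W'.realPeriodRat : ℂ) = ((1 : ℚ) : ℂ)) : BSDp W 3 := by
  have hIW : integralModelInt W = ⟨0, 0, 0, -1730092, -872350528⟩ :=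
    integralModelInt_eq_of_map_eq _ (by rw [hW]; ext <;> simp [WeierstrassCurve.map])
  have hIW' : integralModelInt W' = ⟨0, 0, 0, 7, 0⟩ :=
    integralModelInt_eq_of_map_eq _ (by rw [hW']; ext <;> simp [WeierstrassCurve.map])
  have hX : ClassX8 W 3 := classX8_of_intModel hIW
    (by rw [intCurve_Δ 0 0 0 (-1730092) (-872350528)]; decide +kernel) card_c396704db1_3 (Or.inl rfl)
  have hss' : GoodSS W' 3 := goodSS_of_intModel 3 hIW'
    (by rw [intCurve_Δ 0 0 0 (7) 0]; decide +kernel) card_cm7_3 (by decide)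
  have hap' : W'.frobeniusTrace 3 = 0 := by rw [frobeniusTrace_eq hIW' card_cm7_3]; norm_num
  have hcm' : W'.HasCM := hasCM_of_j_eq_1728 W' (by subst hW'; exact j_shortCM_eq 7)
  have hμ : SignedMuVanishing W' 3 :=
    signedMuVanishing_of_lvalue_three h5 h3 hmodE W' hss' hap' hL1 one_ne_zero (by simp)
  subst hW; subst hW'
  exact X8.bsdp_of_cmPartner_of_transfer_OPEN_of_analyticRank_eq_zero _ _ 3 hCL hPR h5 h3 hmodE hmod hGZK hX h0
    hcm' hss' hap' threeTorsionIso_c396704db1 hμ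

end Records

end Summit.BirchSwinnertonDyer.BirchSwinnertonDyer.Theorems

end
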